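import Summits.BirchSwinnertonDyer.BirchSwinnertonDyer.Theses.UniversalToricDescent
import Literature.NumberTheory.EllipticCurves.BDPAnticyclotomicPAdicLFunctionHigherWeight
import Literature.NumberTheory.EllipticCurves.Newforms
import HarnessLib

/-!
# NODE (D-0171) for crux `stmt-BirchSwinnertonDyer-24207` · `UniversalToricDescent.RationalSplitIMCInclusionAtThree`
# («RATWALL»: `∃ k, 3ᵏ·L ∈ Ch_Λ(X_(∅,0)(E/K_∞))·R₀′⟦T⟧`) — idea g22 `root-continuity-ladder`
# (cruxidea lineage `cruxidea-stmt-BirchSwinnertonDyer-24207-1`, generation 22, 2026-08-31).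

KIND: IMPLIED-BY node, no EQUIV piece (so no child is owed).  Compiles against the route file; `sorry`-free; no new axiom;
kernel theorem `RootContinuityLadder.rationalSplitIMCInclusionAtThree_of_rootContinuityLadder` concludes the crux BY NAME from
five registered-hypothesis pieces P_PRIN, P_LAD, P_AN, P_RUNG, P_CORE (audit class `proof.conditional`).  The rung predicate
`IsLadderRung` and the piece P_LAD are VERBATIM copies of g2's `AdicCongruenceLadder.IsLadderRung` / K1a
`CrystallineLadderAtThree` (node `NodeAdicCongruenceLadderG2.lean`), so the two nodes share their ladder leaf literally; g2's K1b
is copied too and shown to imply the weaker P_AN used here (`ladderCongruenceUpTo_of_K1b`).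

## KEEP / KILL (g22) — no vet / triage / instrument / director event on any 24207 idea since g21 (14:22Z), no
«COVER CLOSED 24207», no `Disproof.lean`, `ledger negatives --problem BirchSwinnertonDyer` = {15532, 24881} (unrelated) ⇒ the g21
table STANDS: KEEP g0 eisenstein-kato-swap · base-doubling-tau-signs · g2 adic-congruence-ladder (AMENDED below: its BARRIER-flagged
piece K1c is bypassed, not needed) · g3 · g5 · g6 · g7 · g8 · g9 · g10 · g11 · g12 · g13 · g14 · g15 · g16 · g17 · g18 · g19 · g20 ·
g21; KILLED (unchanged): universal-toric-half-order, germ-recentred-tempered-heegner, tempered-eisenstein, GU(2,1)-as-supply.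

## THE IDEA (technique class: finite-depth determinacy of Weierstrass data («effective Greenberg–Vatsal») + 3-adic continuity
## of monic long division; object moved = the characteristic DIVISOR, not λ/μ, not membership)

RATWALL is a statement about the DIVISOR of `Ch = (F₀)`, `F₀ = 3^μ·p·u` (`p` distinguished of degree `λ`): it says `p ∣ p_L` in
`R₀′[T]` (root-wise `ord_x L ≥ ord_x F₀` on the open disc).  LEVER (§A(1)): **the Weierstrass data `(μ, p)` of a nonzero principal
ideal of `R₀′⟦T⟧` are determined by the ideal MODULO `3^m` as soon as `m > μ`, the polynomial `p` to precision `3^{m−μ}`** —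
Greenberg–Vatsal / EPW is the case `m = 1`, where only `λ = deg p` survives.  Hence along ANY sequence of rungs `g_m` (newforms of
level `M = N/3^{v₃N}`, weight `k_m ≡ 2 (mod 4·3^m)`, `a_ℓ(g_m) ≡ a_ℓ(f_E) (mod 3^m)`, `ℓ ≠ 3` — g2's K1a, crystalline at 3,
necessarily of slope `→ ∞` by g2's L1):
 (a) ALGEBRAIC SIDE, EXACT up to a FIXED depth loss `c = c(E, K)`: `E[3^m] ≅ T_{g_m}/3^m` (Carayol; `ρ̄` irreducible),
     `E(K_∞)[3] = 0`, and the (∅,0) local conditions over `K_∞` are TYPE-BLIND modulo `3^{m−c}` (at `𝔭`: none; at `𝔭′` and at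
     `v ∣ M`: strict, the comparison error being the local torsion modulo its divisible part — finite, killed by `3^c`, and
     matched for `f_E` and `g_m` through `E[3^m] ≅ T_{g_m}/3^m`) ⇒ `X_f/3^{m−c} ≅ X_{g_m}/3^{m−c}` as `Λ`-modules ⇒ (Fitting
     ideals commute with base change; no nonzero finite submodule ⇒ `Fitt = Ch`) `Ch_f + (3^{m−c}) = Ch_{g_m} + (3^{m−c})`:
     an EXACT congruence of ideals — NO slack;
 (b) ANALYTIC SIDE: `L_{g_m} ≡ L_f (mod 3^{m−c′})` (3-depleted q-expansions congruent, same CM points and periods on the Igusa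
     tower of tame level `M`; print pattern Nguyen 2025 arXiv:2503.00247 Thm 5.10, Kriz–Li 2019 Thm 3.9; = g2's K1b with a loss);
 (c) PER RUNG: the rational BDP-(∅,0) inclusion for `g_m` with ITS OWN, ARBITRARY slack `k_m` (`Ch_{g_m} = (F_m) ∋ 3^{k_m} L_{g_m}`)
     gives `p_{F_m} ∣ p_{L_{g_m}}` as monic polynomials — the slack is INVISIBLE on distinguished polynomials;
 (d) CLOSE (§A(2)): `p_{F_m} → p` and `p_{L_{g_m}} → p_L` coefficientwise (by the lever), quotient and remainder of monic long
     division are polynomial functions of the coefficients ⇒ `Rem(p_L, p) = lim Rem(p_{L_{g_m}}, p_{F_m}) = lim 0 = 0` ⇒ `p ∣ p_L`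
     ⇒ `3^{μ}·L ∈ (F₀)`: RATWALL with `k = μ(Ch)`.
No uniform slack, no Krull closedness, no family ring, no fern density, no `μ = 0` hypothesis, no norm-compatible class for `f_E`.

«WHY NOVEL» (problem-relative, searched 2026-08-31): every transport in the cone moves either `λ/μ` (GV/EPW counts: g0, dead line
24208 RK-6 v2, Nguyen 2025 Thm 7.5; B-g37-1 «counts cannot locate roots»), MEMBERSHIP modulo `3^m` (g2: needs ONE uniform slack
`k₀` — its piece K1c, which g2 itself flagged BARRIER because its rung engines lose `3^{O(slope)}` and L1 forces slope `→ ∞`),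
or a Weierstrass REMAINDER over the universal deformation ring (g21: fern density + family Selmer control + family `μ = 0`).
This node moves the DIVISOR through finite-depth congruences and closes by continuity of long division, so the per-rung input
is a rational inclusion with UNBOUNDED slack — exactly the freedom L1 demands and K1c cannot grant.  Searches: corpus
`lit search "Greenberg Vatsal Iwasawa invariants congruent"` → [corpus: arXiv:2503.00247 Thm A/5.10/7.5 — BDP functions of
mod-ϖ^m-congruent newforms of different weights are congruent mod ϖ^m; the algebraic transport there is λ/μ only and needs the
divisibility for the target form as INPUT], [corpus: arXiv:1706.04531 Hatley–Lei (anticyclotomic, mod p, λ)], [corpus: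
arXiv:2105.06946 (fine Selmer of congruent reps)], [corpus: arXiv:2003.10301 (no finite-index submodules, anticyclotomic ±)];
`lit search --hybrid "congruent modular forms modulo p^n characteristic ideal Selmer Fitting"` / `lit vsearch` → noise (Hida
2000, Delbourgo 2008); `lit search "\"modulo prime powers\" eigenforms"` → [corpus: arXiv:1612.05017, 1710.00928, 1811.05702,
1408.3249 p.13 (CKW strong/weak/dc-weak eigenforms mod p^m; Coleman families of radius `t`; Coleman–Stein 2004 «Approximation of
eigenforms of infinite slope by eigenforms of finite slope»; Yamagami 2012)] = the print locus of P_LAD, none touches Selmer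
divisors; galaxy `"Iwasawa invariants|congruent modular forms"` pdf → [galaxy:pdf Pollack–Weston «Mazur–Tate elements of
nonordinary modular forms», Bellaïche–Pollack] (λ/μ only); `"weak eigenform|eigenforms modulo prime powers"` all stars → 0 hits;
`"modulo prime powers"` pdf, `"distinguished polynomial|Weierstrass preparation"` panama → noise.  No hit transports a
characteristic DIVISOR (as opposed to λ, μ or membership) through mod-p^m congruences.  Nearest: g2 (shared K1a/K1b; delta = P_RUNG +
P_CORE replace K1c + S1).

## PIECES (formal `def`s below; tags per D-0171)
* P_PRIN `PrincipalCharIdealAtThree` [WEAKER · ATTACKABLE (S)]: `Ch·R₀′⟦T⟧ = (F₀)`, `F₀ ≠ 0`.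
* P_LAD `CrystallineLadderAtThree` (= g2 K1a VERBATIM) [UNDECIDED · INSTRUMENTABLE (g2's D-g2-1: does 135a1's eigensystem occur
  mod 9, 27 among newforms of level 5 and weight `≡ 2 (mod 36)`, `(mod 108)`?  kit 0 in this lineage — still unrun) · IDEA-NEEDED on
  the supercuspidal rows (`v₃(N) ∈ {3,5}`, or `4` of unramified-dihedral type): `x_{f_E}` is OFF the finite-slope fern, so a
  3-adically convergent sequence of classical points is a Coleman–Stein approximation, not a Coleman family; on the principal-series
  rows (`v₃(N) = 4`, abelian inertia) the Coleman family through the slope-½ untwist `f_E ⊗ χ₉^{∓1}` supplies rungs of level `81M`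
  — that supply is route `CyclotomicUntwist` / B-g14-4 and is NOT claimed here (and those rungs are not `IsLadderRung`, whose level
  is `M`)].
* P_AN `LadderCongruenceUpToAtThree` [WEAKER than g2's K1b (`ladderCongruenceUpTo_of_K1b`) · ATTACKABLE (M): q-expansion principle
  on the Igusa tower of tame level `M`; `f_E` is a 3-adic modular form of tame level `M` although its level is `27M…243M`; the
  crux's `L` is the additive-reduction BDP transform of the route import `LiuZhangZhang2018.PAdicWaldspurgerEllipticCurveAdditive`].
* P_RUNG `RungDivisorDataAtThree` [UNDECIDED; (i) exact type-blind control = ATTACKABLE (M) (pattern [corpus: arXiv:2003.10301]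
  for the no-finite-submodule input); (ii) rational Kolyvagin-direction BDP inclusion for a crystalline newform of LARGE slope at a
  split prime = IDEA-NEEDED (no engine in print: ordinary — Castella–Hsieh 2018; `a_p = 0`, `k = 2` — Kobayashi–Ota 2020,
  Castella–Wan 2016; Fontaine–Laffaille signed range — Büyükboduk–Lei 2021; BF classes `BF_{g,𝐠_K}` are integral only along the
  `Γ_𝔭`-line).  Rung ASSETS vs `f_E`: `3 ∤` level, integral BDP MEASURE (CM side ordinary), generalized Heegner classes at every
  layer with `a₃(g_m) ≡ 0 (mod 3^{s_m})`, and — the point of this node — ANY finite slack is acceptable].  NOT COSTUME: `g` ranges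
  over newforms of level `M = N/3^{v₃ N} ≠ N`, never over `f_E`; instantiating `F_g := F₀` turns (ii) into `F₀ ∣ 3^k L_g`, a
  different (and implausible) claim, not the crux.
* P_CORE `RootContinuityClosure` [WEAKER · TRUE LEMMA of commutative algebra · ATTACKABLE (M): §A; Mathlib has
  `PowerSeries` Weierstrass preparation over complete local rings].
Amendment to g2 (recorded, not filed there): K1c `UniformLadderInclusionAtThree` is not needed for the ladder line at all; if one
wants it anyway, `k₀ = μ(Ch)` is forced by (a) + per-rung inclusions, because `μ` is itself a depth-`(μ+1)` invariant (§A(1)).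

## §A  Proof sketch of P_CORE (pure algebra in `R = R₀′⟦T⟧`, `R₀′ = unrIntegers 3` a complete DVR with uniformiser 3; `R` is a
## 2-dimensional regular local ring, a UFD, with Weierstrass preparation)
(1) FINITE-DEPTH DETERMINACY.  `F = 3^μ p u`, `F′ = 3^{μ′} p′ u′`, `(F) + (3^m) = (F′) + (3^m)`, `m > μ`.  `F ∈ (F′) + (3^m)` modulo
`3^{μ+1}` gives `μ′ ≤ μ` (else `F ∈ (3^{μ+1})`), then `F′ ∈ (F) + (3^m) ⊆ (3^μ)` gives `μ′ ≥ μ`; divide by `3^μ` (domain):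
`(p) + (3^{m′}) = (p′) + (3^{m′})`, `m′ = m − μ ≥ 1`.  From `p = p′h + 3^{m′}r` modulo 3: `T^λ = T^{λ′}·h̄`, so `λ ≥ λ′`;
symmetrically `λ = λ′`, `h̄ = 1`, `h = 1 + 3h₁`.  Weierstrass-divide `r = p′q + s` (`s` a polynomial, `deg s < λ`):
`p − p′ − 3^{m′}s = p′(3h₁ + 3^{m′}q)`; the left side is a polynomial of degree `< λ`, so uniqueness of Weierstrass division by `p′`
forces it to vanish: `p ≡ p′ (mod 3^{m′} R₀′[T])`, coefficientwise.
(2) CLOSING.  Hypotheses: `I = (F₀)`, `F₀ = 3^μ p u ≠ 0`; `I + (3^m) = (F_m) + (3^m)`; `G_m ≡ Lx (mod 3^m)`; `F_m ∣ 3^{k_m} G_m`.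
If `Lx = 0`, done.  Else `Lx = 3^ν p_L u_L`; for `m > max(μ, ν)`: `F_m ≠ 0`, `G_m ≠ 0`, and by (1) `F_m = 3^μ p_m u_m`,
`G_m = 3^ν q_m u′_m` with `p_m ≡ p (mod 3^{m−μ})`, `q_m ≡ p_L (mod 3^{m−ν})`, `deg p_m = λ`, `deg q_m = λ_L`.  In the UFD `R` the
prime factors of `p_m` are distinguished, hence prime to 3, so `F_m ∣ 3^{k_m}G_m` ⇒ `p_m ∣ q_m`, and (uniqueness of Weierstrass
preparation) the quotient is the monic long-division quotient in `R₀′[T]`.  Remainder of monic long division in fixed degrees is a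
polynomial map in the coefficients, so `Rem(p_L, p) = lim_m Rem(q_m, p_m) = 0` 3-adically, `p ∣ p_L` in `R₀′[T]` (Gauss), and
`3^μ Lx = (3^ν u_L (p_L/p) u^{-1})·F₀ ∈ I`.  ∎  (Rungs with RAMIFIED coefficients `𝒪 ⊋ R₀′`: run (1)–(2) in `𝒪_{ℂ₃}[T]` for the
polynomials — only completeness of the coefficient field is used in the limit — and descend `p ∣ p_L` to `R₀′[T]` by Gauss;
the formal pieces keep `F_g ∈ R₀′⟦T⟧` for simplicity — ATTACKABLE (S) generalisation.)

## LEAVES: P_LAD [UNDECIDED · INSTRUMENTABLE (D-g2-1) / IDEA-NEEDED (SC rows)] · P_RUNG(ii) [IDEA-NEEDED: large-slope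
## anticyclotomic Kolyvagin direction] · P_RUNG(i), P_AN, P_CORE, P_PRIN [ATTACKABLE].  Barrier notes of this generation (in-cone
## kills): g22 HANDOFF `HANDOFF-cruxidea-24207-1-g22.md`.
-/

set_option autoImplicit false
set_option linter.dupNamespace false

noncomputable section

open scoped Classical MatrixGroups ModularForm

namespace Summit.BirchSwinnertonDyer.BirchSwinnertonDyer.Cruxes.RationalSplitIMCInclusionAtThree.RootContinuityLadder

open PowerSeries CongruenceSubgroup Literature.NumberTheory.EllipticCurves
  Literature.NumberTheory.EllipticCurves.ModularForms
  Summit.BirchSwinnertonDyer.Rank1Residual.X11b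

/-! ## §0  Notation-free abbreviations. -/

/-- `3` as an element of `R₀′⟦T⟧ = UnrSeries 3` (the crux's `((3 : ℕ) : UnrSeries 3)`). -/
abbrev three : UnrSeries 3 := ((3 : ℕ) : UnrSeries 3)

/-- **Rung predicate** — VERBATIM copy of g2's `AdicCongruenceLadder.IsLadderRung` (node `NodeAdicCongruenceLadderG2.lean`,
shared so that the ladder-existence piece below is literally g2's K1a): `g ∈ S_k(Γ₀(M))` is an `m`-th rung over
`f ∈ S₂(Γ₀(N))` — same tame level (`M·3^{v₃ N} = N`, so `3 ∤ M` up to the `3`-part of `N`), `g` a newform,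
`k ≡ 2 (mod 4·3^m)`, and `a_ℓ(g) ≡ a_ℓ(f) (mod 3^m)` for every prime `ℓ ≠ 3`. -/
def IsLadderRung (ι' : PadicAlgCl 3 ≃+* ℂ) {N : ℕ} [NeZero N] (f : CuspForm (Gamma0 N) 2) (m : ℕ)
    {M : ℕ} [NeZero M] {k : ℤ} (g : CuspForm (Gamma0 M) k) : Prop :=
  M * 3 ^ (padicValNat 3 N) = N ∧ IsNewform0 g ∧ k ≡ 2 [ZMOD ((4 * 3 ^ m : ℕ) : ℤ)] ∧
    ∀ ℓ : ℕ, ℓ.Prime → ℓ ≠ 3 →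
      ‖(((ι'.symm (heckeEigenvalue g ℓ - heckeEigenvalue f ℓ)) : PadicAlgCl 3) : ℂ_[3])‖ ≤ ((3 : ℝ) ^ m)⁻¹

/-! ## §B  The five pieces. -/

/-- **(P_PRIN) PRINCIPAL NONZERO CHARACTERISTIC (AcSelmer.XAc.charIdeal (W.baseChange K) 3 κ 𝔭' ∅ γ).map (PowerSeries.map (Halves.toUnr 3))** [WEAKER · ATTACKABLE (S)]: under 24207's binders,
`Ch_Λ(X_(∅,0))·R₀′⟦T⟧ = (F₀)` with `F₀ ≠ 0` (`Λ` is a UFD and the tree's `Module.charIdeal` is a finite product of powers of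
height-one primes; `Ideal.map_span`; `toUnr` injective; cf. `charIdeal_ne_bot` in
`Cruxes/PlecticRankUB/Lines/heegner_leading_form_plectic_certificate.lean`). -/
def PrincipalCharIdealAtThree : Prop :=
  ∀ (W : WeierstrassCurve ℚ) [W.IsElliptic] [W.IsGloballyMinimal] (N : ℕ) [NeZero N] (K : Type) [Field K] [NumberField K] (Dt : Literature.NumberTheory.EllipticCurves.ModularForms.ModularParametrizationData W N), Summit.BirchSwinnertonDyer.Rank1Residual.Additive.ClassO6 W 3 → W.HasSurjectiveModNGaloisRep 3 → W.analyticRank = 1 → W.conductorNorm ℤ = N → Literature.NumberTheory.EllipticCurves.IsImaginaryQuadratic K → Literature.NumberTheory.EllipticCurves.SatisfiesHeegnerHypothesis N K → ∀ (κ : Literature.NumberTheory.EllipticCurves.ZpExtension K 3), κ.IsAnticyclotomic → ∀ (γ : Field.absoluteGaloisGroup K) [Fact (κ.IsTopGenerator γ)] (𝔭 : IsDedekindDomain.HeightOneSpectrum (NumberField.RingOfIntegers K)), ((3 : ℕ) : NumberField.RingOfIntegers K) ∈ 𝔭.asIdeal → 𝔭.asIdeal.ramificationIdx (NumberField.RingOfIntegers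 ℚ) = 1 → 𝔭.asIdeal.inertiaDeg (NumberField.RingOfIntegers ℚ) = 1 → ∀ (𝔭' : IsDedekindDomain.HeightOneSpectrum (NumberField.RingOfIntegers K)), ((3 : ℕ) : NumberField.RingOfIntegers K) ∈ 𝔭'.asIdeal → 𝔭' ≠ 𝔭 → ∀ (ι' : PadicAlgCl 3 ≃+* ℂ), Summit.BirchSwinnertonDyer.BirchSwinnertonDyer.Theorems.SchneiderFree.BranchInducesPrime 3 ι' 𝔭 → ∀ (ΩK : ℂ) (Ωp : ℂ_[3]) (L : Literature.NumberTheory.EllipticCurves.UnrSeries 3), ΩK ≠ 0 → Ωp ≠ 0 → Literature.NumberTheory.EllipticCurves.IsBDPLFunction ι' 𝔭 κ γ Dt.f ΩK Ωp L →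
    ∃ F₀ : UnrSeries 3, F₀ ≠ 0 ∧ (AcSelmer.XAc.charIdeal (W.baseChange K) 3 κ 𝔭' ∅ γ).map (PowerSeries.map (Halves.toUnr 3)) = Ideal.span {F₀}

/-- **(P_LAD) THE CRYSTALLINE LADDER EXISTS** — VERBATIM g2's K1a `AdicCongruenceLadder.CrystallineLadderAtThree`
[UNDECIDED · INSTRUMENTABLE (D-g2-1: habitat 135a1, rungs of tame level 5) · IDEA-NEEDED on supercuspidal rows (Coleman–Stein
«approximation of infinite-slope eigenforms by finite-slope eigenforms»; strong vs dc-weak eigenforms mod `3^m`, CKW)]: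
for every depth `m` an `m`-th rung `g` with a BDP function for the SAME `(𝔭, κ, γ, Ω_K, Ω_p)`. -/
def CrystallineLadderAtThree : Prop :=
  ∀ (W : WeierstrassCurve ℚ) [W.IsElliptic] [W.IsGloballyMinimal] (N : ℕ) [NeZero N] (K : Type) [Field K] [NumberField K] (Dt : Literature.NumberTheory.EllipticCurves.ModularForms.ModularParametrizationData W N), Summit.BirchSwinnertonDyer.Rank1Residual.Additive.ClassO6 W 3 → W.HasSurjectiveModNGaloisRep 3 → W.analyticRank = 1 → W.conductorNorm ℤ = N → Literature.NumberTheory.EllipticCurves.IsImaginaryQuadratic K → Literature.NumberTheory.EllipticCurves.SatisfiesHeegnerHypothesis N K → ∀ (κ : Literature.NumberTheory.EllipticCurves.ZpExtension K 3), κ.IsAnticyclotomic → ∀ (γ : Field.absoluteGaloisGroup K) [Fact (κ.IsTopGenerator γ)] (𝔭 : IsDedekindDomain.HeightOneSpectrum (NumberField.RingOfIntegers K)), ((3 : ℕ) : NumberField.RingOfIntegers K) ∈ 𝔭.asIdeal → 𝔭.asIdeal.ramificationIdx (NumberField.RingOfIntegers ℚ) = 1 → 𝔭.asIdeal.inertiaDeg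 (NumberField.RingOfIntegers ℚ) = 1 → ∀ (𝔭' : IsDedekindDomain.HeightOneSpectrum (NumberField.RingOfIntegers K)), ((3 : ℕ) : NumberField.RingOfIntegers K) ∈ 𝔭'.asIdeal → 𝔭' ≠ 𝔭 → ∀ (ι' : PadicAlgCl 3 ≃+* ℂ), Summit.BirchSwinnertonDyer.BirchSwinnertonDyer.Theorems.SchneiderFree.BranchInducesPrime 3 ι' 𝔭 → ∀ (ΩK : ℂ) (Ωp : ℂ_[3]) (L : Literature.NumberTheory.EllipticCurves.UnrSeries 3), ΩK ≠ 0 → Ωp ≠ 0 → Literature.NumberTheory.EllipticCurves.IsBDPLFunction ι' 𝔭 κ γ Dt.f ΩK Ωp L →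
    ∀ m : ℕ, ∃ (M : ℕ) (_ : NeZero M) (k : ℤ) (g : CuspForm (Gamma0 M) k) (Lg : UnrSeries 3),
      IsLadderRung ι' Dt.f m g ∧ IsBDPLFunctionWt ι' 𝔭 κ γ g ΩK Ωp Lg

/-- **g2's K1b, VERBATIM** (`AdicCongruenceLadder.LadderCongruenceAtThree`): congruent forms have congruent BDP functions at
full depth.  Recorded only to show that it implies the weaker piece P_AN actually used here (`ladderCongruenceUpTo_of_K1b`). -/
def LadderCongruenceAtThree : Prop :=
  ∀ (W : WeierstrassCurve ℚ) [W.IsElliptic] [W.IsGloballyMinimal] (N : ℕ) [NeZero N] (K : Type) [Field K] [NumberField K] (Dt : Literature.NumberTheory.EllipticCurves.ModularForms.ModularParametrizationData W N), Summit.BirchSwinnertonDyer.Rank1Residual.Additive.ClassO6 W 3 → W.HasSurjectiveModNGaloisRep 3 → W.analyticRank = 1 → W.conductorNorm ℤ = N → Literature.NumberTheory.EllipticCurves.IsImaginaryQuadratic K → Literature.NumberTheory.EllipticCurves.SatisfiesHeegnerHypothesis N K → ∀ (κ : Literature.NumberTheory.EllipticCurves.ZpExtension K 3), κ.IsAnticyclotomic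 → ∀ (γ : Field.absoluteGaloisGroup K) [Fact (κ.IsTopGenerator γ)] (𝔭 : IsDedekindDomain.HeightOneSpectrum (NumberField.RingOfIntegers K)), ((3 : ℕ) : NumberField.RingOfIntegers K) ∈ 𝔭.asIdeal → 𝔭.asIdeal.ramificationIdx (NumberField.RingOfIntegers ℚ) = 1 → 𝔭.asIdeal.inertiaDeg (NumberField.RingOfIntegers ℚ) = 1 → ∀ (𝔭' : IsDedekindDomain.HeightOneSpectrum (NumberField.RingOfIntegers K)), ((3 : ℕ) : NumberField.RingOfIntegers K) ∈ 𝔭'.asIdeal → 𝔭' ≠ 𝔭 → ∀ (ι' : PadicAlgCl 3 ≃+* ℂ), Summit.BirchSwinnertonDyer.BirchSwinnertonDyer.Theorems.SchneiderFree.BranchInducesPrime 3 ι' 𝔭 → ∀ (ΩK : ℂ) (Ωp : ℂ_[3]) (L : Literature.NumberTheory.EllipticCurves.UnrSeries 3), ΩK ≠ 0 → Ωp ≠ 0 → Literature.NumberTheory.EllipticCurves.IsBDPLFunction ι' 𝔭 κ γ Dt.f ΩK Ωp L →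
    ∀ (m M : ℕ) [NeZero M] (k : ℤ) (g : CuspForm (Gamma0 M) k), IsLadderRung ι' Dt.f m g →
      ∀ Lg : UnrSeries 3, IsBDPLFunctionWt ι' 𝔭 κ γ g ΩK Ωp Lg →
        L - Lg ∈ Ideal.span {((3 : ℕ) : UnrSeries 3) ^ m}

/-- **(P_AN) ANALYTIC CONGRUENCE UP TO A FIXED DEPTH LOSS** [WEAKER (than g2's K1b) · ATTACKABLE (M); print pattern
arXiv:2503.00247 Thm 5.10, Kriz–Li 2019 Thm 3.9]: there is `c′` with `L ≡ Lg (mod 3^{m−c′})` for every `m`-th rung `g` and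
every BDP function `Lg` of `g` in the same frame (`c′` absorbs period units / Euler factors at the tame level). -/
def LadderCongruenceUpToAtThree : Prop :=
  ∀ (W : WeierstrassCurve ℚ) [W.IsElliptic] [W.IsGloballyMinimal] (N : ℕ) [NeZero N] (K : Type) [Field K] [NumberField K] (Dt : Literature.NumberTheory.EllipticCurves.ModularForms.ModularParametrizationData W N), Summit.BirchSwinnertonDyer.Rank1Residual.Additive.ClassO6 W 3 → W.HasSurjectiveModNGaloisRep 3 → W.analyticRank = 1 → W.conductorNorm ℤ = N → Literature.NumberTheory.EllipticCurves.IsImaginaryQuadratic K → Literature.NumberTheory.EllipticCurves.SatisfiesHeegnerHypothesis N K → ∀ (κ : Literature.NumberTheory.EllipticCurves.ZpExtension K 3), κ.IsAnticyclotomic → ∀ (γ : Field.absoluteGaloisGroup K) [Fact (κ.IsTopGenerator γ)] (𝔭 : IsDedekindDomain.HeightOneSpectrum (NumberField.RingOfIntegers K)), ((3 : ℕ) : NumberField.RingOfIntegers K) ∈ 𝔭.asIdeal → 𝔭.asIdeal.ramificationIdx (NumberField.RingOfIntegers ℚ) = 1 → 𝔭.asIdeal.inertiaDeg (NumberField.RingOfIntegers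 ℚ) = 1 → ∀ (𝔭' : IsDedekindDomain.HeightOneSpectrum (NumberField.RingOfIntegers K)), ((3 : ℕ) : NumberField.RingOfIntegers K) ∈ 𝔭'.asIdeal → 𝔭' ≠ 𝔭 → ∀ (ι' : PadicAlgCl 3 ≃+* ℂ), Summit.BirchSwinnertonDyer.BirchSwinnertonDyer.Theorems.SchneiderFree.BranchInducesPrime 3 ι' 𝔭 → ∀ (ΩK : ℂ) (Ωp : ℂ_[3]) (L : Literature.NumberTheory.EllipticCurves.UnrSeries 3), ΩK ≠ 0 → Ωp ≠ 0 → Literature.NumberTheory.EllipticCurves.IsBDPLFunction ι' 𝔭 κ γ Dt.f ΩK Ωp L →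
    ∃ c' : ℕ, ∀ (m M : ℕ) [NeZero M] (k : ℤ) (g : CuspForm (Gamma0 M) k), IsLadderRung ι' Dt.f m g →
      ∀ Lg : UnrSeries 3, IsBDPLFunctionWt ι' 𝔭 κ γ g ΩK Ωp Lg →
        L - Lg ∈ Ideal.span {three ^ (m - c')}

/-- **(P_RUNG) RUNG DIVISOR DATA** [UNDECIDED · the research leaf; NEW relative to g2: NO uniform slack]: there is a depth loss
`c` such that for every `m`-th rung `g` and BDP function `Lg` of `g` there is `F_g ∈ R₀′⟦T⟧` with
(i) `Ch_E·R₀′⟦T⟧ + (3^{m−c}) = (F_g) + (3^{m−c})` — INTENDED `F_g` = a generator of `Ch_Λ(X_(∅,0)(g/K_∞))·R₀′⟦T⟧`, the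
congruence coming from the TYPE-BLIND (∅,0)-Selmer structure modulo `3^{m−c}` (`E[3^m] ≅ T_g/3^m`, `E(K_∞)[3] = 0`, local
torsion at `𝔭′` and at `v ∣ N₀` finite modulo its divisible part, Fitting ideals commute with base change, no finite submodule)
[ATTACKABLE (M)]; and (ii) `∃ k_g, 3^{k_g}·Lg ∈ (F_g)` — the rational Kolyvagin-direction BDP inclusion for the crystalline
rung `g` with ITS OWN, ARBITRARY slack [IDEA-NEEDED: `g` has `3 ∤` level and an integral BDP measure, but slope
`v₃(a₃(g)) → ∞` along the ladder (g2's L1), and no anticyclotomic Kolyvagin-direction engine for large slope is in print —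
ordinary: Castella–Hsieh 2018; `a_p = 0`, `k = 2`: Kobayashi–Ota 2020, Castella–Wan; Fontaine–Laffaille signed range:
Büyükboduk–Lei 2021].  NOT COSTUME: `g` ranges over newforms of level prime to the `3`-part of `N`, never over `f_E`. -/
def RungDivisorDataAtThree : Prop :=
  ∀ (W : WeierstrassCurve ℚ) [W.IsElliptic] [W.IsGloballyMinimal] (N : ℕ) [NeZero N] (K : Type) [Field K] [NumberField K] (Dt : Literature.NumberTheory.EllipticCurves.ModularForms.ModularParametrizationData W N), Summit.BirchSwinnertonDyer.Rank1Residual.Additive.ClassO6 W 3 → W.HasSurjectiveModNGaloisRep 3 → W.analyticRank = 1 → W.conductorNorm ℤ = N → Literature.NumberTheory.EllipticCurves.IsImaginaryQuadratic K → Literature.NumberTheory.EllipticCurves.SatisfiesHeegnerHypothesis N K → ∀ (κ : Literature.NumberTheory.EllipticCurves.ZpExtension K 3), κ.IsAnticyclotomic → ∀ (γ : Field.absoluteGaloisGroup K) [Fact (κ.IsTopGenerator γ)] (𝔭 : IsDedekindDomain.HeightOneSpectrum (NumberField.RingOfIntegers K)), ((3 : ℕ) : NumberField.RingOfIntegers K)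 ∈ 𝔭.asIdeal → 𝔭.asIdeal.ramificationIdx (NumberField.RingOfIntegers ℚ) = 1 → 𝔭.asIdeal.inertiaDeg (NumberField.RingOfIntegers ℚ) = 1 → ∀ (𝔭' : IsDedekindDomain.HeightOneSpectrum (NumberField.RingOfIntegers K)), ((3 : ℕ) : NumberField.RingOfIntegers K) ∈ 𝔭'.asIdeal → 𝔭' ≠ 𝔭 → ∀ (ι' : PadicAlgCl 3 ≃+* ℂ), Summit.BirchSwinnertonDyer.BirchSwinnertonDyer.Theorems.SchneiderFree.BranchInducesPrime 3 ι' 𝔭 → ∀ (ΩK : ℂ) (Ωp : ℂ_[3]) (L : Literature.NumberTheory.EllipticCurves.UnrSeries 3), ΩK ≠ 0 → Ωp ≠ 0 → Literature.NumberTheory.EllipticCurves.IsBDPLFunction ι' 𝔭 κ γ Dt.f ΩK Ωp L →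
    ∃ c : ℕ, ∀ (m M : ℕ) [NeZero M] (k : ℤ) (g : CuspForm (Gamma0 M) k), IsLadderRung ι' Dt.f m g →
      ∀ Lg : UnrSeries 3, IsBDPLFunctionWt ι' 𝔭 κ γ g ΩK Ωp Lg →
        ∃ Fg : UnrSeries 3,
          (AcSelmer.XAc.charIdeal (W.baseChange K) 3 κ 𝔭' ∅ γ).map (PowerSeries.map (Halves.toUnr 3)) ⊔ Ideal.span {three ^ (m - c)} =
              Ideal.span {Fg} ⊔ Ideal.span {three ^ (m - c)} ∧
            ∃ kg : ℕ, three ^ kg * Lg ∈ Ideal.span {Fg}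

/-- **(P_CORE) ROOT-CONTINUITY CLOSURE** [WEAKER · true lemma of commutative algebra (§A of the module docstring) ·
ATTACKABLE (M)]: in `R₀′⟦T⟧`, a nonzero principal ideal `I`, elements `F m` congruent to `I` modulo `3^m`, elements
`G m → Lx` `3`-adically, and divisibilities `F m ∣ 3^{k_m}·G m` with ARBITRARY `k_m` force `∃ k, 3^k·Lx ∈ I`
(finite-depth determinacy of Weierstrass data + continuity of monic long division; `k = μ(I)` works). -/
def RootContinuityClosure : Prop :=
  ∀ (I : Ideal (UnrSeries 3)) (Lx : UnrSeries 3) (F G : ℕ → UnrSeries 3),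
    (∃ F₀ : UnrSeries 3, F₀ ≠ 0 ∧ I = Ideal.span {F₀}) →
      (∀ m : ℕ, I ⊔ Ideal.span {three ^ m} = Ideal.span {F m} ⊔ Ideal.span {three ^ m}) →
        (∀ m : ℕ, G m - Lx ∈ Ideal.span {three ^ m}) →
          (∀ m : ℕ, ∃ k : ℕ, three ^ k * G m ∈ Ideal.span {F m}) →
            ∃ k : ℕ, three ^ k * Lx ∈ I

/-! ## §C  Kernel theorems. -/

/-- g2's full-depth K1b implies the up-to-loss version used here (`c′ = 0`). -/
theorem ladderCongruenceUpTo_of_K1b (h : LadderCongruenceAtThree) : LadderCongruenceUpToAtThree := by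
  intro W _ _ N _ K _ _ Dt hO6 hsurj hr1 hN hK hH κ hκ γ _ 𝔭 h𝔭 he hf 𝔭' h𝔭' hne ι' hι ΩK Ωp L hΩK hΩp hL
  refine ⟨0, ?_⟩
  intro m M _ k g hg Lg hLg
  simpa using h W N K Dt hO6 hsurj hr1 hN hK hH κ hκ γ 𝔭 h𝔭 he hf 𝔭' h𝔭' hne ι' hι ΩK Ωp L hΩK hΩp hL m M k g hg Lg hLg

/-- Depth bookkeeping [PROVED]: `(3^{m + c}) ≤ (3^m)`. -/
theorem span_three_pow_add_le (m c : ℕ) :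
    Ideal.span {three ^ (m + c)} ≤ Ideal.span {three ^ m} :=
  Ideal.span_singleton_le_span_singleton.mpr (pow_dvd_pow three (Nat.le_add_right m c))

/-- Depth bookkeeping [PROVED]: a congruence of ideals modulo `3^{m+c}` implies the one modulo `3^m`. -/
theorem sup_span_eq_of_deeper {I J : Ideal (UnrSeries 3)} (m c : ℕ)
    (h : I ⊔ Ideal.span {three ^ (m + c)} = J ⊔ Ideal.span {three ^ (m + c)}) :
    I ⊔ Ideal.span {three ^ m} = J ⊔ Ideal.span {three ^ m} := by
  have hle : Ideal.span {three ^ (m + c)} ⊔ Ideal.span {three ^ m} = Ideal.span {three ^ m} :=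
    sup_eq_right.mpr (span_three_pow_add_le m c)
  calc I ⊔ Ideal.span {three ^ m}
        = I ⊔ (Ideal.span {three ^ (m + c)} ⊔ Ideal.span {three ^ m}) := by rw [hle]
    _ = (I ⊔ Ideal.span {three ^ (m + c)}) ⊔ Ideal.span {three ^ m} := by rw [sup_assoc]
    _ = (J ⊔ Ideal.span {three ^ (m + c)}) ⊔ Ideal.span {three ^ m} := by rw [h]
    _ = J ⊔ (Ideal.span {three ^ (m + c)} ⊔ Ideal.span {three ^ m}) := by rw [sup_assoc]
    _ = J ⊔ Ideal.span {three ^ m} := by rw [hle]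

/-- **KERNEL (BY NAME).**  P_PRIN + P_LAD + P_AN + P_RUNG + P_CORE ⟹ `UniversalToricDescent.RationalSplitIMCInclusionAtThree`:
on each row, pick for every `m` a rung at depth `m + c + c′` (P_LAD), take its divisor datum `F_g` (P_RUNG) and BDP function
`Lg` (P_AN), and close with P_CORE. -/
theorem rationalSplitIMCInclusionAtThree_of_rootContinuityLadder
    (hP : PrincipalCharIdealAtThree) (hLad : CrystallineLadderAtThree) (hAn : LadderCongruenceUpToAtThree)
    (hR : RungDivisorDataAtThree) (hC : RootContinuityClosure) :
    Summit.BirchSwinnertonDyer.BirchSwinnertonDyer.Theses.UniversalToricDescent.RationalSplitIMCInclusionAtThree := by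
  intro W _ _ N _ K _ _ Dt hO6 hsurj hr1 hN hK hH κ hκ γ _ 𝔭 h𝔭 he hf 𝔭' h𝔭' hne ι' hι ΩK Ωp L hΩK hΩp hL
  obtain ⟨F₀, hF₀, hI⟩ := hP W N K Dt hO6 hsurj hr1 hN hK hH κ hκ γ 𝔭 h𝔭 he hf 𝔭' h𝔭' hne ι' hι ΩK Ωp L hΩK hΩp hL
  have hLad' := hLad W N K Dt hO6 hsurj hr1 hN hK hH κ hκ γ 𝔭 h𝔭 he hf 𝔭' h𝔭' hne ι' hι ΩK Ωp L hΩK hΩp hL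
  obtain ⟨c', hc'⟩ := hAn W N K Dt hO6 hsurj hr1 hN hK hH κ hκ γ 𝔭 h𝔭 he hf 𝔭' h𝔭' hne ι' hι ΩK Ωp L hΩK hΩp hL
  obtain ⟨c, hc⟩ := hR W N K Dt hO6 hsurj hr1 hN hK hH κ hκ γ 𝔭 h𝔭 he hf 𝔭' h𝔭' hne ι' hι ΩK Ωp L hΩK hΩp hL
  have key : ∀ m : ℕ, ∃ (F G : UnrSeries 3),
      (AcSelmer.XAc.charIdeal (W.baseChange K) 3 κ 𝔭' ∅ γ).map (PowerSeries.map (Halves.toUnr 3)) ⊔ Ideal.span {three ^ m} =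
          Ideal.span {F} ⊔ Ideal.span {three ^ m} ∧
        G - L ∈ Ideal.span {three ^ m} ∧ ∃ kg : ℕ, three ^ kg * G ∈ Ideal.span {F} := by
    intro m
    obtain ⟨M, hM, k, g, Lg, hg, hLg⟩ := hLad' (m + c' + c)
    haveI : NeZero M := hM
    obtain ⟨Fg, hFg, kg, hkg⟩ := hc (m + c' + c) M k g hg Lg hLg
    have hcong := hc' (m + c' + c) M k g hg Lg hLg
    refine ⟨Fg, Lg, ?_, ?_, kg, hkg⟩
    · have h0 : m + c' + c - c = m + c' := by omega
      rw [h0] at hFg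
      exact sup_span_eq_of_deeper m c' hFg
    · have h1 : L - Lg ∈ Ideal.span {three ^ m} := by
        have h2 : m + c' + c - c' = m + c := by omega
        rw [h2] at hcong
        exact span_three_pow_add_le m c hcong
      have h3 : Lg - L = -(L - Lg) := (neg_sub L Lg).symm
      rw [h3]
      exact Submodule.neg_mem _ h1
  choose F G hF hG hK using key
  exact hC _ L F G ⟨F₀, hF₀, hI⟩ hF hG hK

end Summit.BirchSwinnertonDyer.BirchSwinnertonDyer.Cruxes.RationalSplitIMCInclusionAtThree.RootContinuityLadder

end
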